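import Mathlib.Algebra.Group.Pointwise.Finset.Basic
import Mathlib.Tactic
import HarnessLib

/-!
# Route `GreenTaoLevelTwo`, crux `GITwo` (stmt-Parity-21275), line `birth`, stub `stub_cyclicInverse`:
# a graph slice with `4Γ'' − 4Γ''` a graph carries a locally additive section on `2H'' − 2H''`

Nineteenth helper file toward the XL stub `stub_cyclicInverse` (B. Green, T. Tao, arXiv:math/0503014,
Thm. 68 = PEMS 51 (2008) Thm. 12.8).  First step of arXiv Prop. 43 after Lemma 44 (files
`…LinearSlice`, `…GraphSliceOfU3`): if `Γ''` is nonempty and `4Γ'' − 4Γ''` is a graph, then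
`2Γ'' − 2Γ'' ⊆ 4Γ'' − 4Γ''` is a graph over `2H'' − 2H''` (`H'' = pr₁Γ''`), i.e. there is a
section `μ` with `(h, μ h) ∈ 2Γ'' − 2Γ''` for `h ∈ 2H'' − 2H''`, and `μ` is ADDITIVE wherever this
makes sense: `μ(h₁ + h₂) = μ h₁ + μ h₂` whenever `h₁, h₂, h₁ + h₂ ∈ 2H'' − 2H''`.  With Bogolyubov
(`…BogolyubovBohr`: `B(Spec, ¼) ⊆ 2H'' − 2H''`) this is the locally linear map of Prop. 43.
Everything is def-free and generic (any additive commutative groups).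

* `two_sub_two_subset_four_sub_four` — `2Γ − 2Γ ⊆ 4Γ − 4Γ` for nonempty `Γ`;
* `fst_two_sub_two` — `pr₁(2Γ − 2Γ) = 2·pr₁Γ − 2·pr₁Γ`;
* `exists_locally_additive_section` — the section `μ` and its local additivity.

References: [GreenTao2008U3Inverse] arXiv:math/0503014, Prop. 43 (proof, definition of `M`);
Lemma 29 / Prop. 28 (model case).
-/

namespace Summit.Parity.GeneralizedHardyLittlewood.GreenTaoLevelTwoGITwoCyclicInverse

open Finset
open scoped Pointwise

variable {α β : Type*} [AddCommGroup α] [AddCommGroup β] [DecidableEq α] [DecidableEq β]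

/-- `2Γ − 2Γ ⊆ 4Γ − 4Γ` for a nonempty finset (add and subtract `e + e`). [folklore] -/
theorem two_sub_two_subset_four_sub_four (Γ : Finset (α × β)) (hne : Γ.Nonempty) :
    2 • Γ - 2 • Γ ⊆ 4 • Γ - 4 • Γ := by
  obtain ⟨e, he⟩ := hne
  intro x hx
  rw [Finset.mem_sub] at hx ⊢
  obtain ⟨a, ha, b, hb, rfl⟩ := hx
  have h2e : e + e ∈ 2 • Γ := by
    rw [two_nsmul]; exact add_mem_add he he
  refine ⟨a + (e + e), ?_, b + (e + e), ?_, by abel⟩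
  · rw [show (4 : ℕ) = 2 + 2 from rfl, add_nsmul]; exact add_mem_add ha h2e
  · rw [show (4 : ℕ) = 2 + 2 from rfl, add_nsmul]; exact add_mem_add hb h2e

/-- The first projection commutes with iterated sumsets: `pr₁(nΓ) = n·pr₁Γ`. [folklore] -/
theorem image_fst_nsmul (Γ : Finset (α × β)) (n : ℕ) :
    (n • Γ).image Prod.fst = n • Γ.image Prod.fst := by
  have hf : (Prod.fst : α × β → α) = ⇑(AddMonoidHom.fst α β) := rfl
  induction n with
  | zero =>
    rw [zero_nsmul, zero_nsmul, ← Finset.singleton_zero, image_singleton, Prod.fst_zero,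
      Finset.singleton_zero]
  | succ n ih => rw [succ_nsmul, succ_nsmul, hf, image_add, ← hf, ih]

/-- `pr₁(s − t) = pr₁ s − pr₁ t`. [folklore] -/
theorem image_fst_sub (s t : Finset (α × β)) :
    (s - t).image Prod.fst = s.image Prod.fst - t.image Prod.fst := by
  have hf : (Prod.fst : α × β → α) = ⇑(AddMonoidHom.fst α β) := rfl
  rw [hf]
  exact image_image₂_distrib (map_sub (AddMonoidHom.fst α β))

/-- `pr₁(nΓ − nΓ) = n·pr₁Γ − n·pr₁Γ`. [folklore] -/
theorem image_fst_nsmul_sub_nsmul (Γ : Finset (α × β)) (n : ℕ) :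
    (n • Γ - n • Γ).image Prod.fst = n • Γ.image Prod.fst - n • Γ.image Prod.fst := by
  rw [image_fst_sub, image_fst_nsmul]

/-- **Locally additive section of a graph slice.** If `Γ` is nonempty and `4Γ − 4Γ` is a graph, there
is `μ : α → β` with `(h, μ h) ∈ 2Γ − 2Γ` for every `h ∈ 2H − 2H` (`H = pr₁Γ`), `μ p.1 = p.2` for every
`p ∈ 2Γ − 2Γ`, and `μ(h₁ + h₂) = μ h₁ + μ h₂` whenever `h₁, h₂, h₁ + h₂ ∈ 2H − 2H`.
[cite: GreenTao2008U3Inverse, Prop. 43 (proof: the map `M`)] -/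
theorem exists_locally_additive_section (Γ : Finset (α × β)) (hne : Γ.Nonempty)
    (hgraph : Set.InjOn Prod.fst ((4 • Γ - 4 • Γ : Finset (α × β)) : Set (α × β))) :
    ∃ μ : α → β,
      (∀ p ∈ 2 • Γ - 2 • Γ, μ p.1 = p.2) ∧
      (∀ h ∈ 2 • Γ.image Prod.fst - 2 • Γ.image Prod.fst, (h, μ h) ∈ 2 • Γ - 2 • Γ) ∧
      (∀ h₁ h₂, h₁ ∈ 2 • Γ.image Prod.fst - 2 • Γ.image Prod.fst →
        h₂ ∈ 2 • Γ.image Prod.fst - 2 • Γ.image Prod.fst →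
        h₁ + h₂ ∈ 2 • Γ.image Prod.fst - 2 • Γ.image Prod.fst →
        μ (h₁ + h₂) = μ h₁ + μ h₂) := by
  classical
  have hsub := two_sub_two_subset_four_sub_four Γ hne
  -- the section: pick, for each `h`, some `p ∈ 2Γ − 2Γ` over `h` (or `0`)
  have hproj : ∀ h ∈ 2 • Γ.image Prod.fst - 2 • Γ.image Prod.fst, ∃ p ∈ 2 • Γ - 2 • Γ, p.1 = h := by
    intro h hh
    rw [← image_fst_nsmul_sub_nsmul, mem_image] at hh
    obtain ⟨p, hp, rfl⟩ := hh
    exact ⟨p, hp, rfl⟩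
  let μ : α → β := fun h =>
    if hh : h ∈ 2 • Γ.image Prod.fst - 2 • Γ.image Prod.fst then ((hproj h hh).choose).2 else 0
  have hμmem : ∀ h ∈ 2 • Γ.image Prod.fst - 2 • Γ.image Prod.fst, (h, μ h) ∈ 2 • Γ - 2 • Γ := by
    intro h hh
    have hspec := (hproj h hh).choose_spec
    have hval : μ h = ((hproj h hh).choose).2 := by
      show (if hh : h ∈ 2 • Γ.image Prod.fst - 2 • Γ.image Prod.fst then ((hproj h hh).choose).2 else 0) = _
      rw [dif_pos hh]
    rw [hval]
    have : ((hproj h hh).choose) = (h, ((hproj h hh).choose).2) := Prod.ext hspec.2 rfl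
    rw [← this]
    exact hspec.1
  -- uniqueness from the graph property of `4Γ − 4Γ ⊇ 2Γ − 2Γ`
  have huniq : ∀ p ∈ 2 • Γ - 2 • Γ, ∀ q ∈ 4 • Γ - 4 • Γ, p.1 = q.1 → p.2 = q.2 := by
    intro p hp q hq h
    have := hgraph (mem_coe.mpr (hsub hp)) (mem_coe.mpr hq) h
    rw [this]
  refine ⟨μ, ?_, hμmem, ?_⟩
  · intro p hp
    have hh : p.1 ∈ 2 • Γ.image Prod.fst - 2 • Γ.image Prod.fst := by
      rw [← image_fst_nsmul_sub_nsmul]; exact mem_image_of_mem _ hp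
    have h1 := hμmem p.1 hh
    exact (huniq p hp (p.1, μ p.1) (hsub h1) rfl).symm
  · intro h₁ h₂ hh₁ hh₂ hh₁₂
    have h1 := hμmem h₁ hh₁
    have h2 := hμmem h₂ hh₂
    have h12 := hμmem (h₁ + h₂) hh₁₂
    -- `(h₁, μh₁) + (h₂, μh₂) ∈ 4Γ − 4Γ` has first coordinate `h₁ + h₂`
    have hsum : (h₁, μ h₁) + (h₂, μ h₂) ∈ 4 • Γ - 4 • Γ := by
      rw [Finset.mem_sub] at h1 h2
      obtain ⟨a, ha, b, hb, hab⟩ := h1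
      obtain ⟨c, hc, d, hd, hcd⟩ := h2
      rw [← hab, ← hcd, show a - b + (c - d) = (a + c) - (b + d) by abel]
      refine Finset.sub_mem_sub ?_ ?_
      · rw [show (4 : ℕ) = 2 + 2 from rfl, add_nsmul]; exact add_mem_add ha hc
      · rw [show (4 : ℕ) = 2 + 2 from rfl, add_nsmul]; exact add_mem_add hb hd
    have := huniq (h₁ + h₂, μ (h₁ + h₂)) h12 ((h₁, μ h₁) + (h₂, μ h₂)) hsum rfl
    simpa using this

end Summit.Parity.GeneralizedHardyLittlewood.GreenTaoLevelTwoGITwoCyclicInverse
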